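import Mathlib

/-!
# Window Descartes rule — definitions: `firstNZ`, `sgnChanges`, `slist`

The three elementary notions used by the kernel form of the WINDOW DESCARTES RULE (GAP-LIFT §7 of seat val-sym-lift-p4;
the «window localisation» technique named in the docstring of the plan-only rung `stub_weakLiftRungEdge` of the
`WeakLifting` skeleton, stmt-ValiantsHypothesis-19561; sequel files `…WindowDescartesSigns`, `…WindowDescartesSmoothing`,
`…WindowDescartesKernel`, `…WindowDescartes`):
* `firstNZ l` — the first non-zero entry of a list of reals (`0` if none);
* `sgnChanges l` — the number of SIGN CHANGES of a list of reals, zero entries ignored (the quantity of Descartes' rule;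
  for a polynomial `P`, Mathlib's `P.signVariations = sgnChanges P.coeffList`, proved in `…WindowDescartesSmoothing`);
* `slist c n = [c n, c (n-1), …, c 0]` — a finite sequence as a list, in the orientation of `Polynomial.coeffList`.
Mathlib has `Polynomial.signVariations` only for coefficient lists of polynomials; the window rule needs the same count
for value lists `[f(x₀), …, f(xₙ)]` and for smoothed coefficient sequences, hence the list-level definition.
HONEST FRAMING: definitions and `rfl` lemmas only; nothing of the cell is asserted. [folklore]
-/

set_option linter.dupNamespace false
set_option autoImplicit false

namespace Summit.ValiantsHypothesis.ValiantsHypothesis.Theorems.KPlusLogSqLaw.WindowDescartes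

open Polynomial

/-! ## `firstNZ`, `sgnChanges` -/

/-- the first non-zero entry of a list of reals (`0` if there is none). -/
noncomputable def firstNZ : List ℝ → ℝ
  | [] => 0
  | x :: l => if x = 0 then firstNZ l else x

/-- the number of sign changes of a list of reals, zero entries ignored: reading the list from the head, an entry
`x` contributes a change iff `x · y < 0` for the first non-zero entry `y` after it. -/
noncomputable def sgnChanges : List ℝ → ℕ
  | [] => 0
  | x :: l => sgnChanges l + if x * firstNZ l < 0 then 1 else 0

/-- auxiliary (firstNZ nil). [folklore] -/
@[simp] theorem firstNZ_nil : firstNZ [] = 0 := rfl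

/-- auxiliary (firstNZ cons). [folklore] -/
theorem firstNZ_cons (x : ℝ) (l : List ℝ) : firstNZ (x :: l) = if x = 0 then firstNZ l else x := rfl

/-- auxiliary (sgnChanges nil). [folklore] -/
@[simp] theorem sgnChanges_nil : sgnChanges [] = 0 := rfl

/-- auxiliary (sgnChanges cons). [folklore] -/
theorem sgnChanges_cons (x : ℝ) (l : List ℝ) :
    sgnChanges (x :: l) = sgnChanges l + if x * firstNZ l < 0 then 1 else 0 := rfl

/-! ## `slist` -/

/-- the list `[c n, c (n-1), …, c 0]` (head = highest index, as in `Polynomial.coeffList`). -/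
def slist (c : ℕ → ℝ) (n : ℕ) : List ℝ := ((List.range (n + 1)).reverse).map c

/-- auxiliary (slist zero). [folklore] -/
@[simp] theorem slist_zero (c : ℕ → ℝ) : slist c 0 = [c 0] := rfl

/-- auxiliary (slist succ). [folklore] -/
theorem slist_succ (c : ℕ → ℝ) (n : ℕ) : slist c (n + 1) = c (n + 1) :: slist c n := by
  simp [slist, List.range_succ]
end Summit.ValiantsHypothesis.ValiantsHypothesis.Theorems.KPlusLogSqLaw.WindowDescartes
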